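import Literature.Barriers.NavierStokesRegularity.NavierStokesInequalityStructureBasics
import Literature.Barriers.NavierStokesRegularity.NavierStokesInequalitySwirlLaplacian
import Literature.Analysis.FluidPDE.NormalisedPressureInteractionCore
import Literature.Analysis.FluidPDE.NormalisedPressureFarFieldHessian
import HarnessLib

/-!
# The pressure interaction function of a structure: limit, maximum, decay (Ożański, Lemma 3.5)

Barrier catalogue support file for `NavierStokesRegularity` (D-0021), on the discharge path of
fact C `Literature.Barriers.NavierStokesRegularity.NSIArrangementExists` of
`NavierStokesInequalityArrangement` (existence of the geometric arrangement; W. S. Ożański,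
arXiv:1709.00602v4, §5 = V. Scheffer, Comm. Math. Phys. 101 (1985), §§4, 6). The whole of §5
("copies of `U`", the sum `H` with (i)–(vi) of §5.2, Lemma 5.3, the choice of `E`, `κ`, `d`, `r`)
is driven by the analytic properties of the pressure interaction function `F = F[v,f] =
∇p[0,f] - ∇p[v,f]` of a structure `(v,f,φ)` collected in Ożański's **Lemma 3.5** (= Lemma 7 of
the held plain-text rendering; Scheffer's hypotheses (4.1)–(4.4) of §4, verified in his
Lemma 6.2 from Lemma 6.1). This file PROVES, for the tree's `pressureInteraction v f` of an
`IsNSIStructure U v f φ` (everything a `theorem`; no definitions, no named facts):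

* **(i)** `tendsto_pow_four_mul_pressureInteraction_atTop` / `…_atBot`:
  `s⁴ F_axial(0,s) → ±D` as `s → ±∞`, `D = (9/4π) ∫_{ℝ³} v_z(R⁻¹y)² dy` (printed:
  `lim_{x₁→±∞} x₁⁴F₁(x₁,0) = ±(9/4π)∫ v₁²(y₁,√(y₂²+y₃²)) dy =: ±D`) — from the quadrupole limit
  (3.5) of the two pressures `p*[0,f]`, `p*[v,f]` (`NormalisedPressureInteractionCore`,
  `NormalisedPressureFarFieldLimit`), the fields `u[0,f]`, `u[v,f]` having the common modulus `f`
  and axial components `0`, `v_z` (`norm_swirlField_zero_eq`, `inner_eZ_swirlField`); the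
  smoothness clause `F ∈ C^∞` of (i) is the tree's `IsNSIStructure.contDiff_pressureInteraction`;
* **(ii)** `exists_isMaxOn_pressureInteraction_axis`: if `v_z ≢ 0` then `D > 0`
  (`interactionLimit_pos`) and `F_axial(0,·)` attains a positive maximum `B = F_axial(0,A)`;
* **(iii)** `exists_pressureInteraction_decay`: `∃ C > 0, |F(q)| ≤ C/|q|⁴, |∇F(q)| ≤ C/|q|⁵`
  (`q ≠ 0`) — far out from the decay (3.4) of `∇p*`, `D²p*` (`NormalisedPressureFarField`,
  `NormalisedPressureFarFieldHessian`) through `|F(q)| ≤ |∇p*[0,f]| + |∇p*[v,f]|` and the chain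
  rule `DF = Φ ∘ D²p* ∘ M` (`norm_fderiv_pressureInteraction_le`), near the origin by continuity;
* **(v)** `pressureInteraction_snd_near_axis` (uniform form, every half-width `κ` and tolerance
  `ε`) and `pressureInteraction_snd_near_axis_printed` (`κ = 10⁴C/D`, `ε = 0.001D`): for `n ≥ N`,
  `|z - n| < κ`, `|r| < 1` imply `|F_axial(r,z) - n⁻⁴D| ≤ ε n⁻⁴` — proof as printed
  (`|n⁴ - z⁴| ≤ C̃z³`, (i) on the axis, the mean value theorem in `r` with (iii)).

Part **(iv)** (`F_radial = 0` on the axis) is not repeated here (it is the symmetry statement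
`∂ₓ₂p*(x₁,0,x₃) = 0`, (3.24), whose core is `fderiv_apply_eq_zero_of_comp_eq` of
`NormalisedPressureInteractionCore`).

## Rendering

Dictionary as in `NavierStokesInequalityArrangement`: the axis is the `x 2`-axis, a plane point
is `q = (r, z)` (Ożański's `(x₂, x₁)`), his axis points `(x₁, 0)` are `(0, s)`, his `F₁` (axial
component) is `(pressureInteraction v f q).2` and his `F₂` is `(…).1`, his `v₁` is `v_z = (v q).2`;
`R⁻¹ = meridian`, the meridian embedding `(r,z) ↦ (r,0,z)` is `meridianPoint`, with
`meridianPoint (0,s) = s • eZ`. Norms on `ℝ × ℝ` are sup norms (`max(|r|,|z|)`) and `|∇F|` is the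
operator norm of the Fréchet derivative; the printed Euclidean statements follow with the
constant multiplied by an absolute factor, immaterial since `C` is existential. In (v), `n` is
real (printed "`n ≥ N`"; used in Lemma 5.3 with `n = κ/ε`).

## Mathlib search

`Convex.norm_image_sub_le_of_norm_fderiv_le` (mean value inequality), `cocompact_eq_atBot_atTop`,
`IsCompact.exists_bound_of_continuousOn`, `MeasureTheory.integral_pos_iff_support_of_nonneg`,
`IsOpen.measure_pos`, `ContinuousLinearMap.opNorm_comp_le`, `PiLp.norm_apply_le` (used).

## References

* W. S. Ożański, *On weak solutions to the Navier–Stokes inequality with internal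
  singularities*, arXiv:1709.00602v4, §3.2 ((3.4)–(3.5)), §3.3, §3.6 (3.34) and Lemma 3.5
  (i)–(iii), (v) with its proof; used in §5.2 (i)–(vi), Lemma 5.3. [`Ozanski2017NSISingular`]
  (Held plain-text rendering: "Lemma 7".)
* V. Scheffer, *A solution to the Navier–Stokes inequality with an internal singularity*,
  Comm. Math. Phys. 101 (1985), 47–85: §4 hypotheses (4.1)–(4.4) and (4.14)–(4.17) (p. 68, 70),
  Lemma 6.1 ((6.2)–(6.3), p. 78), Lemma 6.2 ((6.13)–(6.15), (6.24)–(6.26), pp. 78–80).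
  [`Scheffer1985`]
-/

noncomputable section

open MeasureTheory Set Function Filter Topology TopologicalSpace WithLp Metric Real
open scoped ENNReal InnerProductSpace RealInnerProductSpace ContDiff

namespace Literature.Barriers.NavierStokesRegularity

open Literature.Analysis.FluidPDE

variable {U : Set (ℝ × ℝ)} {v : ℝ × ℝ → ℝ × ℝ} {f φ : ℝ × ℝ → ℝ}

/-! ### The axial component of `u[v,f]` and the common modulus of `u[0,f]`, `u[v,f]` -/

/-- `⟪x̂_axis, ρ̂⟫ = 0`. [folklore] -/
theorem inner_eZ_eR (x : EuclideanSpace ℝ (Fin 3)) : ⟪eZ, eR x⟫ = 0 := by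
  rw [real_inner_comm]; exact inner_eR_eZ x

/-- `⟪x̂_axis, φ̂⟫ = 0`. [folklore] -/
theorem inner_eZ_eTheta (x : EuclideanSpace ℝ (Fin 3)) : ⟪eZ, eTheta x⟫ = 0 := by
  rw [real_inner_comm]; exact inner_eTheta_eZ x

/-- `⟪x̂_axis, x̂_axis⟫ = 1`. [folklore] -/
theorem inner_eZ_eZ : ⟪eZ, eZ⟫ = (1 : ℝ) := by
  rw [eZ, EuclideanSpace.inner_single_left]
  simp

/-- `‖x̂_axis‖ = 1`. [folklore] -/
theorem norm_eZ_eq_one : ‖(eZ : EuclideanSpace ℝ (Fin 3))‖ = 1 := by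
  rw [norm_eq_sqrt_real_inner (F := EuclideanSpace ℝ (Fin 3)), inner_eZ_eZ, Real.sqrt_one]

/-- **The axial component of `u[v,f]` is `v_z ∘ R⁻¹`**: `⟪x̂_axis, u[v,f](y)⟫ = v_z(R⁻¹y)`
(Ożański, proof of Lemma 3.2 (i): `u₁[v,f](x₁,ρ,φ) = v₁(x₁,ρ)`, and proof of Lemma 3.5 (i):
`u₁[v,f](y) = v₁(R⁻¹(y))`). [cite: Ozanski2017NSISingular, §3.3 (proof of Lemma 3.2 (i)) and §3.6 (proof of Lemma 3.5 (i))] -/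
theorem inner_eZ_swirlField (v : ℝ × ℝ → ℝ × ℝ) (f : ℝ × ℝ → ℝ) (y : EuclideanSpace ℝ (Fin 3)) :
    ⟪eZ, swirlField v f y⟫ = (v (meridian y)).2 := by
  simp only [swirlField, inner_add_right, inner_smul_right, inner_eZ_eR, inner_eZ_eTheta,
    inner_eZ_eZ, mul_zero, mul_one, zero_add, add_zero]

/-- The pure swirl `u[0,f] = f φ̂` is orthogonal to the axis: `⟪x̂_axis, u[0,f](y)⟫ = 0`
(Ożański, proof of Lemma 3.5 (i): `u₁[0,f] = 0`). [cite: Ozanski2017NSISingular, §3.6 (proof of Lemma 3.5 (i))] -/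
theorem inner_eZ_swirlField_zero (f : ℝ × ℝ → ℝ) (y : EuclideanSpace ℝ (Fin 3)) :
    ⟪eZ, swirlField 0 f y⟫ = 0 := by
  rw [inner_eZ_swirlField]; rfl

namespace IsNSIStructure

/-- `(0, f, φ)` is a structure whenever `(v, f, φ)` is (the case `a = 0` of the remark after
Definition 3.3). [cite: Ozanski2017NSISingular, Definition 3.3 (remark)] -/
theorem zero_field (h : IsNSIStructure U v f φ) : IsNSIStructure U 0 f φ := by
  have h0 : IsNSIStructure U ((0 : ℝ) • v) f φ := h.smul (a := 0) (by norm_num)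
  rwa [zero_smul] at h0

/-- **`|u[0,f]| = |u[v,f]|` pointwise** for a structure (both equal `f ∘ R⁻¹`, (3.11)).
[cite: Ozanski2017NSISingular, §3.3 (3.11)] -/
theorem norm_swirlField_zero_eq (h : IsNSIStructure U v f φ) (y : EuclideanSpace ℝ (Fin 3)) :
    ‖swirlField 0 f y‖ = ‖swirlField v f y‖ := by
  by_cases hy : meridian y ∈ U
  · have hr : cylRadius y ≠ 0 := by
      have : 0 < (meridian y).1 := h.subset_halfPlane hy
      simpa using this.ne'
    rw [norm_swirlField hr (h.f_nonneg _) (by simpa using sq_nonneg (f (meridian y))),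
      norm_swirlField hr (h.f_nonneg _) (h.sq_lt _ hy).le]
  · have hv : v (meridian y) = 0 :=
      image_eq_zero_of_notMem_tsupport fun h' => hy (h.tsupport_v_subset h')
    simp only [swirlField, hv, Pi.zero_apply]

end IsNSIStructure

/-! ### Lemma 3.5 (i): the far-field limit on the axis -/

/-- The meridian point of an axis point: `(0, s) ↦ s x̂_axis`. [folklore] -/
theorem meridianPoint_zero_eq_smul (s : ℝ) :
    meridianPoint ((0 : ℝ), s) = s • (eZ : EuclideanSpace ℝ (Fin 3)) := by
  ext i
  fin_cases i <;> simp [meridianPoint, eZ]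

/-- `p[v,f]` as the restriction of `p*[v,f]` to the meridian plane (definitional unfolding).
[cite: Ozanski2017NSISingular, §3.3 (3.20)] -/
theorem planePressure_eq_comp (v : ℝ × ℝ → ℝ × ℝ) (f : ℝ × ℝ → ℝ) :
    planePressure v f = fun q => normalisedPressure (swirlField v f) (meridianPoint q) := rfl

namespace IsNSIStructure

/-- The planar derivatives of `p[v,f]` are the derivatives of `p*[v,f]` at meridian points:
`∂ᵣ p[v,f](q) = ∂₀ p*[v,f](q₁,0,q₂)`. [cite: Ozanski2017NSISingular, §3.3 (3.20)–(3.21)] -/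
theorem derivR_planePressure (h : IsNSIStructure U v f φ) (q : ℝ × ℝ) :
    derivR (planePressure v f) q = fderiv ℝ (normalisedPressure (swirlField v f)) (meridianPoint q)
      (EuclideanSpace.single (0 : Fin 3) (1 : ℝ)) := by
  rw [planePressure_eq_comp]
  exact derivR_comp_meridianPoint
    ((h.contDiff_normalisedPressure_swirlField.differentiable (by simp)) _)

/-- `∂_z p[v,f](q) = ∂_axis p*[v,f](q₁,0,q₂)`. [cite: Ozanski2017NSISingular, §3.3 (3.20)–(3.21)] -/
theorem derivZ_planePressure (h : IsNSIStructure U v f φ) (q : ℝ × ℝ) :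
    derivZ (planePressure v f) q =
      fderiv ℝ (normalisedPressure (swirlField v f)) (meridianPoint q) eZ := by
  rw [planePressure_eq_comp]
  exact derivZ_comp_meridianPoint
    ((h.contDiff_normalisedPressure_swirlField.differentiable (by simp)) _)

/-- **The axial component of `F[v,f]` on the axis** is the difference of the axial derivatives
of the two pressures `p*[0,f]`, `p*[v,f]` at `s x̂_axis` (Ożański's `F₁(x₁,0)`).
[cite: Ozanski2017NSISingular, §3.6 (3.34)] -/
theorem pressureInteraction_snd_axis (h : IsNSIStructure U v f φ) (s : ℝ) :
    (pressureInteraction v f (0, s)).2 =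
      fderiv ℝ (normalisedPressure (swirlField 0 f)) (s • eZ) eZ -
        fderiv ℝ (normalisedPressure (swirlField v f)) (s • eZ) eZ := by
  rw [pressureInteraction, h.zero_field.derivZ_planePressure, h.derivZ_planePressure,
    meridianPoint_zero_eq_smul]

/-- **Lemma 3.5 (i), `x₁ → +∞`** (Ożański 2017): for a structure `(v,f,φ)` on `U`,
`lim_{s→+∞} s⁴ F_axial(0,s) = D := (9/4π) ∫_{ℝ³} v_z(R⁻¹y)² dy` (printed:
`lim_{x₁→±∞} x₁⁴F₁(x₁,0) = ±(9/4π)∫ v₁²(y₁,√(y₂²+y₃²)) dy =: ±D`; from (3.5) applied to `u[0,f]`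
and `u[v,f]`, which have the same modulus `f` and axial components `0`, `v₁`).
[cite: Ozanski2017NSISingular, Lemma 3.5 (i)] [cite: Scheffer1985, Lemma 6.1 (6.2) and (6.24)] -/
theorem tendsto_pow_four_mul_pressureInteraction_atTop (h : IsNSIStructure U v f φ) :
    Tendsto (fun s : ℝ => s ^ 4 * (pressureInteraction v f (0, s)).2) atTop
      (𝓝 (9 / (4 * π) * ∫ y, (v (meridian y)).2 ^ 2)) := by
  have h0 := h.zero_field
  have key := tendsto_pow_four_mul_sub_fderiv_normalisedPressure_atTop
    (h0.contDiff_swirlField.of_le (by decide)) h0.hasCompactSupport_swirlField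
    (h.contDiff_swirlField.of_le (by decide)) h.hasCompactSupport_swirlField norm_eZ_eq_one
    h.norm_swirlField_zero_eq (inner_eZ_swirlField_zero f)
  simp only [inner_eZ_swirlField] at key
  refine key.congr fun s => ?_
  rw [h.pressureInteraction_snd_axis]

/-- **Lemma 3.5 (i), `x₁ → -∞`**: `lim_{s→-∞} s⁴ F_axial(0,s) = -D`.
[cite: Ozanski2017NSISingular, Lemma 3.5 (i)] -/
theorem tendsto_pow_four_mul_pressureInteraction_atBot (h : IsNSIStructure U v f φ) :
    Tendsto (fun s : ℝ => s ^ 4 * (pressureInteraction v f (0, s)).2) atBot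
      (𝓝 (-(9 / (4 * π)) * ∫ y, (v (meridian y)).2 ^ 2)) := by
  have h0 := h.zero_field
  have key := tendsto_pow_four_mul_sub_fderiv_normalisedPressure_atBot
    (h0.contDiff_swirlField.of_le (by decide)) h0.hasCompactSupport_swirlField
    (h.contDiff_swirlField.of_le (by decide)) h.hasCompactSupport_swirlField norm_eZ_eq_one
    h.norm_swirlField_zero_eq (inner_eZ_swirlField_zero f)
  simp only [inner_eZ_swirlField] at key
  refine key.congr fun s => ?_
  rw [h.pressureInteraction_snd_axis]

end IsNSIStructure

/-! ### Lemma 3.5 (iii): decay of `F[v,f]` and of `∇F[v,f]` -/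

/-- The sup norm of a planar point is at most the Euclidean norm of its meridian point:
`max(|r|,|z|) ≤ |(r,0,z)|`. [folklore] -/
theorem norm_le_norm_meridianPoint (q : ℝ × ℝ) : ‖q‖ ≤ ‖meridianPoint q‖ := by
  rw [Prod.norm_def]
  refine max_le ?_ ?_
  · simpa [meridianPoint] using PiLp.norm_apply_le (meridianPoint q) 0
  · simpa [meridianPoint] using PiLp.norm_apply_le (meridianPoint q) 2

/-- `‖x̂₀‖ = 1` for the first coordinate vector. [folklore] -/
theorem norm_single_zero_eq_one : ‖(EuclideanSpace.single (0 : Fin 3) (1 : ℝ))‖ = 1 := by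
  rw [norm_eq_sqrt_real_inner (F := EuclideanSpace ℝ (Fin 3)), EuclideanSpace.inner_single_left]
  simp

/-- `|(r,0,z)| ≤ |r| + |z| ≤ 2 max(|r|,|z|)`. [folklore] -/
theorem norm_meridianPoint_le (q : ℝ × ℝ) : ‖meridianPoint q‖ ≤ 2 * ‖q‖ := by
  have h : meridianPoint q = q.1 • EuclideanSpace.single (0 : Fin 3) (1 : ℝ) + q.2 • eZ := by
    rw [meridianPoint_eq_clm]; simp
  rw [h]
  calc ‖q.1 • EuclideanSpace.single (0 : Fin 3) (1 : ℝ) + q.2 • (eZ : EuclideanSpace ℝ (Fin 3))‖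
      ≤ ‖q.1 • EuclideanSpace.single (0 : Fin 3) (1 : ℝ)‖ + ‖q.2 • (eZ : EuclideanSpace ℝ (Fin 3))‖ :=
        norm_add_le _ _
    _ = ‖q.1‖ + ‖q.2‖ := by rw [norm_smul, norm_smul, norm_single_zero_eq_one, norm_eZ_eq_one]; ring
    _ ≤ ‖q‖ + ‖q‖ := add_le_add (norm_fst_le q) (norm_snd_le q)
    _ = 2 * ‖q‖ := by ring

/-- The derivative of the meridian embedding has operator norm `≤ 2` (sup norm on `ℝ × ℝ`).
[folklore] -/
theorem norm_meridianPointCLM_le :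
    ‖((ContinuousLinearMap.fst ℝ ℝ ℝ).smulRight (EuclideanSpace.single (0 : Fin 3) (1 : ℝ)) +
        (ContinuousLinearMap.snd ℝ ℝ ℝ).smulRight (eZ : EuclideanSpace ℝ (Fin 3)))‖ ≤ 2 :=
  ContinuousLinearMap.opNorm_le_bound _ zero_le_two fun q => by
    rw [← meridianPoint_eq_clm]; exact norm_meridianPoint_le q

namespace IsNSIStructure

/-- **`F[v,f]` through the two pressures**: `F[v,f](q) = (∂₀(p*[0,f] - p*[v,f]),
∂_axis(p*[0,f] - p*[v,f]))(q₁,0,q₂)`. [cite: Ozanski2017NSISingular, §3.6 (3.34)] -/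
theorem pressureInteraction_eq (h : IsNSIStructure U v f φ) (q : ℝ × ℝ) :
    pressureInteraction v f q =
      (fderiv ℝ (normalisedPressure (swirlField 0 f)) (meridianPoint q)
          (EuclideanSpace.single (0 : Fin 3) (1 : ℝ)) -
        fderiv ℝ (normalisedPressure (swirlField v f)) (meridianPoint q)
          (EuclideanSpace.single (0 : Fin 3) (1 : ℝ)),
      fderiv ℝ (normalisedPressure (swirlField 0 f)) (meridianPoint q) eZ -
        fderiv ℝ (normalisedPressure (swirlField v f)) (meridianPoint q) eZ) := by
  rw [pressureInteraction, h.zero_field.derivR_planePressure, h.derivR_planePressure,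
    h.zero_field.derivZ_planePressure, h.derivZ_planePressure]

/-- `|F[v,f](q)| ≤ |∇p*[0,f](q₁,0,q₂)| + |∇p*[v,f](q₁,0,q₂)|`. [folklore] -/
theorem norm_pressureInteraction_le (h : IsNSIStructure U v f φ) (q : ℝ × ℝ) :
    ‖pressureInteraction v f q‖ ≤
      ‖fderiv ℝ (normalisedPressure (swirlField 0 f)) (meridianPoint q)‖ +
        ‖fderiv ℝ (normalisedPressure (swirlField v f)) (meridianPoint q)‖ := by
  set L₀ := fderiv ℝ (normalisedPressure (swirlField 0 f)) (meridianPoint q) with hL₀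
  set L := fderiv ℝ (normalisedPressure (swirlField v f)) (meridianPoint q) with hL
  have key : ∀ e : EuclideanSpace ℝ (Fin 3), ‖e‖ = 1 → ‖L₀ e - L e‖ ≤ ‖L₀‖ + ‖L‖ := fun e he =>
    (norm_sub_le _ _).trans (add_le_add ((L₀.le_opNorm e).trans (by rw [he, mul_one]))
      ((L.le_opNorm e).trans (by rw [he, mul_one])))
  rw [h.pressureInteraction_eq, Prod.norm_def]
  exact max_le (key _ norm_single_zero_eq_one) (key _ norm_eZ_eq_one)

/-- **`|∇F[v,f](q)| ≤ 2 (|D²p*[0,f](q₁,0,q₂)| + |D²p*[v,f](q₁,0,q₂)|)`** (operator norms, sup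
norm on `ℝ × ℝ`): by the chain rule `DF(q) = Φ ∘ D²p*[0,f](Mq) ∘ M - Φ ∘ D²p*[v,f](Mq) ∘ M` with the
meridian embedding `M` (`‖M‖ ≤ 2`) and the evaluation `Φ : L ↦ (L x̂₀, L x̂_axis)` (`‖Φ‖ ≤ 1`).
[folklore] -/
theorem norm_fderiv_pressureInteraction_le (h : IsNSIStructure U v f φ) (q : ℝ × ℝ) :
    ‖fderiv ℝ (pressureInteraction v f) q‖ ≤
      2 * (‖fderiv ℝ (fderiv ℝ (normalisedPressure (swirlField 0 f))) (meridianPoint q)‖ +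
        ‖fderiv ℝ (fderiv ℝ (normalisedPressure (swirlField v f))) (meridianPoint q)‖) := by
  set Φ : (EuclideanSpace ℝ (Fin 3) →L[ℝ] ℝ) →L[ℝ] ℝ × ℝ :=
    (ContinuousLinearMap.apply ℝ ℝ (EuclideanSpace.single (0 : Fin 3) (1 : ℝ))).prod
      (ContinuousLinearMap.apply ℝ ℝ (eZ : EuclideanSpace ℝ (Fin 3))) with hΦ
  set M : ℝ × ℝ →L[ℝ] EuclideanSpace ℝ (Fin 3) :=
    (ContinuousLinearMap.fst ℝ ℝ ℝ).smulRight (EuclideanSpace.single (0 : Fin 3) (1 : ℝ)) +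
      (ContinuousLinearMap.snd ℝ ℝ ℝ).smulRight (eZ : EuclideanSpace ℝ (Fin 3)) with hM
  set P₀ := normalisedPressure (swirlField 0 f) with hP₀
  set P := normalisedPressure (swirlField v f) with hP
  set H₀ := fderiv ℝ (fderiv ℝ P₀) (meridianPoint q) with hH₀
  set H := fderiv ℝ (fderiv ℝ P) (meridianPoint q) with hH
  -- the chain rule
  have hF : pressureInteraction v f =
      fun q' => Φ (fderiv ℝ P₀ (meridianPoint q')) - Φ (fderiv ℝ P (meridianPoint q')) := by
    funext q'
    rw [h.pressureInteraction_eq q']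
    simp [hΦ, hP₀, hP]
  have hD : ∀ {w : ℝ × ℝ → ℝ × ℝ}, IsNSIStructure U w f φ → ∀ x : EuclideanSpace ℝ (Fin 3),
      HasFDerivAt (fderiv ℝ (normalisedPressure (swirlField w f)))
        (fderiv ℝ (fderiv ℝ (normalisedPressure (swirlField w f))) x) x := fun hw x =>
    (((hw.contDiff_normalisedPressure_swirlField.fderiv_right (m := 1) (by decide)).differentiable
      one_ne_zero) x).hasFDerivAt
  have hderiv : HasFDerivAt (pressureInteraction v f)
      (Φ.comp (H₀.comp M) - Φ.comp (H.comp M)) q := by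
    rw [hF]
    exact (Φ.hasFDerivAt.comp q ((hD h.zero_field _).comp q (hasFDerivAt_meridianPoint q))).sub
      (Φ.hasFDerivAt.comp q ((hD h _).comp q (hasFDerivAt_meridianPoint q)))
  -- operator norms
  have hΦn : ‖Φ‖ ≤ 1 := by
    refine ContinuousLinearMap.opNorm_le_bound _ zero_le_one fun L => ?_
    rw [one_mul, Prod.norm_def]
    simp only [hΦ, ContinuousLinearMap.prod_apply, ContinuousLinearMap.apply_apply]
    exact max_le ((L.le_opNorm _).trans (by rw [norm_single_zero_eq_one, mul_one]))
      ((L.le_opNorm _).trans (by rw [norm_eZ_eq_one, mul_one]))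
  have hMn : ‖M‖ ≤ 2 := norm_meridianPointCLM_le
  have key : ∀ T : EuclideanSpace ℝ (Fin 3) →L[ℝ] EuclideanSpace ℝ (Fin 3) →L[ℝ] ℝ,
      ‖Φ.comp (T.comp M)‖ ≤ 2 * ‖T‖ := fun T =>
    calc ‖Φ.comp (T.comp M)‖ ≤ ‖Φ‖ * ‖T.comp M‖ := ContinuousLinearMap.opNorm_comp_le _ _
      _ ≤ 1 * (‖T‖ * ‖M‖) := by
          gcongr
          exact ContinuousLinearMap.opNorm_comp_le _ _
      _ ≤ 1 * (‖T‖ * 2) := by gcongr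
      _ = 2 * ‖T‖ := by ring
  rw [hderiv.fderiv]
  calc ‖Φ.comp (H₀.comp M) - Φ.comp (H.comp M)‖
      ≤ ‖Φ.comp (H₀.comp M)‖ + ‖Φ.comp (H.comp M)‖ := norm_sub_le _ _
    _ ≤ 2 * ‖H₀‖ + 2 * ‖H‖ := add_le_add (key _) (key _)
    _ = 2 * (‖H₀‖ + ‖H‖) := by ring

/-- **Far-field decay of `F[v,f]`** (from (3.4), first half, for the two pressures): if both
`u[0,f]` and `u[v,f]` are supported in `B̄(0,R)` and `C` is a decay constant for pressure
gradients (`NormalisedPressureFarField`), then `|F[v,f](q)| ≤ 16 C (‖u[0,f]‖₂² + ‖u[v,f]‖₂²)/|q|⁴`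
for `|q| ≥ 2R + 4`. [cite: Ozanski2017NSISingular, Lemma 3.5 (iii) with (3.4)] -/
theorem norm_pressureInteraction_le_of_le_norm (h : IsNSIStructure U v f φ) {R C : ℝ} (hR : 0 ≤ R)
    (h₀ : tsupport (swirlField 0 f) ⊆ closedBall (0 : EuclideanSpace ℝ (Fin 3)) R)
    (h₁ : tsupport (swirlField v f) ⊆ closedBall (0 : EuclideanSpace ℝ (Fin 3)) R) (hC0 : 0 ≤ C)
    (hC : ∀ (w : EuclideanSpace ℝ (Fin 3) → EuclideanSpace ℝ (Fin 3)) (R' : ℝ)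
      (x : EuclideanSpace ℝ (Fin 3)), ContDiff ℝ 2 w →
      tsupport w ⊆ closedBall (0 : EuclideanSpace ℝ (Fin 3)) R' → R' + 2 < ‖x‖ →
        ‖fderiv ℝ (normalisedPressure w) x‖ ≤ C * (∫ y, ‖w y‖ ^ 2) / (‖x‖ - R') ^ 4)
    {q : ℝ × ℝ} (hq : 2 * R + 4 ≤ ‖q‖) :
    ‖pressureInteraction v f q‖ ≤
      16 * C * ((∫ y, ‖swirlField 0 f y‖ ^ 2) + ∫ y, ‖swirlField v f y‖ ^ 2) / ‖q‖ ^ 4 := by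
  set x := meridianPoint q with hx
  have hqx : ‖q‖ ≤ ‖x‖ := norm_le_norm_meridianPoint q
  have hfar : R + 2 < ‖x‖ := by linarith
  have hq0 : 0 < ‖q‖ := by linarith
  have hE₀ : 0 ≤ ∫ y, ‖swirlField 0 f y‖ ^ 2 := integral_nonneg fun _ => by positivity
  have hE₁ : 0 ≤ ∫ y, ‖swirlField v f y‖ ^ 2 := integral_nonneg fun _ => by positivity
  have b₀ := hC _ R x (h.zero_field.contDiff_swirlField.of_le (by decide)) h₀ hfar
  have b₁ := hC _ R x (h.contDiff_swirlField.of_le (by decide)) h₁ hfar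
  have hF := h.norm_pressureInteraction_le q
  generalize (∫ y, ‖swirlField 0 f y‖ ^ 2) = E₀ at *
  generalize (∫ y, ‖swirlField v f y‖ ^ 2) = E₁ at *
  generalize ‖fderiv ℝ (normalisedPressure (swirlField 0 f)) x‖ = G₀ at *
  generalize ‖fderiv ℝ (normalisedPressure (swirlField v f)) x‖ = G₁ at *
  have hd : ‖q‖ / 2 ≤ ‖x‖ - R := by linarith
  have hd0 : 0 < ‖q‖ / 2 := by linarith
  have hpow : (‖q‖ / 2) ^ 4 ≤ (‖x‖ - R) ^ 4 := pow_le_pow_left₀ hd0.le hd 4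
  have hpow0 : 0 < (‖q‖ / 2) ^ 4 := pow_pos hd0 4
  have hCE : 0 ≤ C * (E₀ + E₁) := mul_nonneg hC0 (add_nonneg hE₀ hE₁)
  calc ‖pressureInteraction v f q‖ ≤ G₀ + G₁ := hF
    _ ≤ C * E₀ / (‖x‖ - R) ^ 4 + C * E₁ / (‖x‖ - R) ^ 4 := add_le_add b₀ b₁
    _ = C * (E₀ + E₁) / (‖x‖ - R) ^ 4 := by ring
    _ ≤ C * (E₀ + E₁) / (‖q‖ / 2) ^ 4 := div_le_div_of_nonneg_left hCE hpow0 hpow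
    _ = 16 * C * (E₀ + E₁) / ‖q‖ ^ 4 := by
          field_simp
          ring

/-- **Far-field decay of `∇F[v,f]`** (from (3.4), second half):
`|∇F[v,f](q)| ≤ 64 C (‖u[0,f]‖₂² + ‖u[v,f]‖₂²)/|q|⁵` for `|q| ≥ 2R + 4`, `C` a decay constant for
pressure Hessians (`NormalisedPressureFarFieldHessian`).
[cite: Ozanski2017NSISingular, Lemma 3.5 (iii) with (3.4)] -/
theorem norm_fderiv_pressureInteraction_le_of_le_norm (h : IsNSIStructure U v f φ) {R C : ℝ}
    (hR : 0 ≤ R)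
    (h₀ : tsupport (swirlField 0 f) ⊆ closedBall (0 : EuclideanSpace ℝ (Fin 3)) R)
    (h₁ : tsupport (swirlField v f) ⊆ closedBall (0 : EuclideanSpace ℝ (Fin 3)) R) (hC0 : 0 ≤ C)
    (hC : ∀ (w : EuclideanSpace ℝ (Fin 3) → EuclideanSpace ℝ (Fin 3)) (R' : ℝ)
      (x : EuclideanSpace ℝ (Fin 3)), ContDiff ℝ 2 w →
      tsupport w ⊆ closedBall (0 : EuclideanSpace ℝ (Fin 3)) R' → R' + 2 < ‖x‖ →
        ‖fderiv ℝ (fderiv ℝ (normalisedPressure w)) x‖ ≤ C * (∫ y, ‖w y‖ ^ 2) / (‖x‖ - R') ^ 5)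
    {q : ℝ × ℝ} (hq : 2 * R + 4 ≤ ‖q‖) :
    ‖fderiv ℝ (pressureInteraction v f) q‖ ≤
      64 * C * ((∫ y, ‖swirlField 0 f y‖ ^ 2) + ∫ y, ‖swirlField v f y‖ ^ 2) / ‖q‖ ^ 5 := by
  set x := meridianPoint q with hx
  have hqx : ‖q‖ ≤ ‖x‖ := norm_le_norm_meridianPoint q
  have hfar : R + 2 < ‖x‖ := by linarith
  have hq0 : 0 < ‖q‖ := by linarith
  have hE₀ : 0 ≤ ∫ y, ‖swirlField 0 f y‖ ^ 2 := integral_nonneg fun _ => by positivity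
  have hE₁ : 0 ≤ ∫ y, ‖swirlField v f y‖ ^ 2 := integral_nonneg fun _ => by positivity
  have b₀ := hC _ R x (h.zero_field.contDiff_swirlField.of_le (by decide)) h₀ hfar
  have b₁ := hC _ R x (h.contDiff_swirlField.of_le (by decide)) h₁ hfar
  have hF := h.norm_fderiv_pressureInteraction_le q
  generalize (∫ y, ‖swirlField 0 f y‖ ^ 2) = E₀ at *
  generalize (∫ y, ‖swirlField v f y‖ ^ 2) = E₁ at *
  generalize ‖fderiv ℝ (fderiv ℝ (normalisedPressure (swirlField 0 f))) x‖ = G₀ at *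
  generalize ‖fderiv ℝ (fderiv ℝ (normalisedPressure (swirlField v f))) x‖ = G₁ at *
  have hd : ‖q‖ / 2 ≤ ‖x‖ - R := by linarith
  have hd0 : 0 < ‖q‖ / 2 := by linarith
  have hpow : (‖q‖ / 2) ^ 5 ≤ (‖x‖ - R) ^ 5 := pow_le_pow_left₀ hd0.le hd 5
  have hpow0 : 0 < (‖q‖ / 2) ^ 5 := pow_pos hd0 5
  have hCE : 0 ≤ 2 * C * (E₀ + E₁) := by positivity
  calc ‖fderiv ℝ (pressureInteraction v f) q‖ ≤ 2 * (G₀ + G₁) := hF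
    _ ≤ 2 * (C * E₀ / (‖x‖ - R) ^ 5 + C * E₁ / (‖x‖ - R) ^ 5) := by gcongr
    _ = 2 * C * (E₀ + E₁) / (‖x‖ - R) ^ 5 := by ring
    _ ≤ 2 * C * (E₀ + E₁) / (‖q‖ / 2) ^ 5 := div_le_div_of_nonneg_left hCE hpow0 hpow
    _ = 64 * C * (E₀ + E₁) / ‖q‖ ^ 5 := by
          field_simp
          ring

/-- **Lemma 3.5 (iii)** (Ożański 2017): for a structure `(v,f,φ)` on `U` there is `C > 0` with
`|F[v,f](q)| ≤ C/|q|⁴` and `|∇F[v,f](q)| ≤ C/|q|⁵` for all `q ≠ 0` in the plane (printed: "for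
`x ∈ ℝ²`"; at `q = 0` the printed right-hand side is `+∞`). Norms: the sup norm `max(|r|,|z|)` of
`ℝ × ℝ` and the operator norm of the Fréchet derivative — equivalent to the printed Euclidean
moduli up to the absolute factor `4` (resp. `4√2·2`), immaterial as `C` is existential. Far from
the origin this is the decay (3.4) of the two pressures `p*[0,f]`, `p*[v,f]` (Scheffer 1985,
Lemma 6.1 (6.3)); near the origin it is continuity of `F ∈ C^∞` (Lemma 3.5 (i)).
[cite: Ozanski2017NSISingular, Lemma 3.5 (iii)] [cite: Scheffer1985, Lemma 6.1 (6.3) and (6.25)] -/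
theorem exists_pressureInteraction_decay (h : IsNSIStructure U v f φ) :
    ∃ C : ℝ, 0 < C ∧ ∀ q : ℝ × ℝ, q ≠ 0 →
      ‖pressureInteraction v f q‖ ≤ C / ‖q‖ ^ 4 ∧
        ‖fderiv ℝ (pressureInteraction v f) q‖ ≤ C / ‖q‖ ^ 5 := by
  -- a common support radius
  obtain ⟨R₀, hR₀0, hR₀⟩ := exists_tsupport_subset_closedBall h.zero_field.hasCompactSupport_swirlField
  obtain ⟨R₁, -, hR₁⟩ := exists_tsupport_subset_closedBall h.hasCompactSupport_swirlField
  set R := max R₀ R₁ with hRdef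
  have hR : 0 ≤ R := hR₀0.trans (le_max_left _ _)
  have h₀ : tsupport (swirlField 0 f) ⊆ closedBall (0 : EuclideanSpace ℝ (Fin 3)) R :=
    hR₀.trans (closedBall_subset_closedBall (le_max_left _ _))
  have h₁ : tsupport (swirlField v f) ⊆ closedBall (0 : EuclideanSpace ℝ (Fin 3)) R :=
    hR₁.trans (closedBall_subset_closedBall (le_max_right _ _))
  -- the far-field constants
  obtain ⟨C₁, hC₁0, hC₁⟩ := exists_norm_fderiv_normalisedPressure_le
  obtain ⟨C₂, hC₂0, hC₂⟩ := exists_norm_fderiv_fderiv_normalisedPressure_le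
  set E := (∫ y, ‖swirlField 0 f y‖ ^ 2) + ∫ y, ‖swirlField v f y‖ ^ 2 with hEdef
  have hE : 0 ≤ E :=
    add_nonneg (integral_nonneg fun _ => by positivity) (integral_nonneg fun _ => by positivity)
  -- the near-field constants
  set ρ := 2 * R + 4 with hρdef
  have hρ : 0 < ρ := by positivity
  obtain ⟨M₁, hM₁⟩ := (isCompact_closedBall (0 : ℝ × ℝ) ρ).exists_bound_of_continuousOn
    h.continuous_pressureInteraction.continuousOn
  obtain ⟨M₂, hM₂⟩ := (isCompact_closedBall (0 : ℝ × ℝ) ρ).exists_bound_of_continuousOn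
    (h.contDiff_pressureInteraction.continuous_fderiv (by decide)).continuousOn
  -- the constant
  refine ⟨16 * C₁ * E + 64 * C₂ * E + |M₁| * ρ ^ 4 + |M₂| * ρ ^ 5 + 1, by positivity,
    fun q hq => ?_⟩
  have hq0 : 0 < ‖q‖ := norm_pos_iff.2 hq
  have hA : 0 ≤ 16 * C₁ * E := by positivity
  have hB : 0 ≤ 64 * C₂ * E := by positivity
  have hM₁' : 0 ≤ |M₁| * ρ ^ 4 := by positivity
  have hM₂' : 0 ≤ |M₂| * ρ ^ 5 := by positivity
  rcases le_or_gt ρ ‖q‖ with hfar | hnear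
  · -- far field
    constructor
    · refine (h.norm_pressureInteraction_le_of_le_norm hR h₀ h₁ hC₁0 hC₁ hfar).trans ?_
      exact div_le_div_of_nonneg_right (by linarith) (by positivity)
    · refine (h.norm_fderiv_pressureInteraction_le_of_le_norm hR h₀ h₁ hC₂0 hC₂ hfar).trans ?_
      exact div_le_div_of_nonneg_right (by linarith) (by positivity)
  · -- near field: `q` lies in the compact ball
    have hqK : q ∈ closedBall (0 : ℝ × ℝ) ρ := by
      rw [mem_closedBall, dist_zero_right]; exact hnear.le
    have hq4 : ‖q‖ ^ 4 ≤ ρ ^ 4 := pow_le_pow_left₀ hq0.le hnear.le 4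
    have hq5 : ‖q‖ ^ 5 ≤ ρ ^ 5 := pow_le_pow_left₀ hq0.le hnear.le 5
    constructor
    · calc ‖pressureInteraction v f q‖ ≤ |M₁| := (hM₁ q hqK).trans (le_abs_self _)
        _ ≤ |M₁| * ρ ^ 4 / ‖q‖ ^ 4 := by
            rw [le_div_iff₀ (by positivity)]
            exact mul_le_mul_of_nonneg_left hq4 (abs_nonneg _)
        _ ≤ _ := div_le_div_of_nonneg_right (by linarith) (by positivity)
    · calc ‖fderiv ℝ (pressureInteraction v f) q‖ ≤ |M₂| := (hM₂ q hqK).trans (le_abs_self _)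
        _ ≤ |M₂| * ρ ^ 5 / ‖q‖ ^ 5 := by
            rw [le_div_iff₀ (by positivity)]
            exact mul_le_mul_of_nonneg_left hq5 (abs_nonneg _)
        _ ≤ _ := div_le_div_of_nonneg_right (by linarith) (by positivity)

/-! ### Lemma 3.5 (ii): the positive maximum on the axis -/

/-- `D = (9/4π)∫ v_z(R⁻¹y)² dy ≥ 0`. [folklore] -/
theorem interactionLimit_nonneg (v : ℝ × ℝ → ℝ × ℝ) :
    0 ≤ 9 / (4 * π) * ∫ y : EuclideanSpace ℝ (Fin 3), (v (meridian y)).2 ^ 2 :=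
  mul_nonneg (by positivity) (integral_nonneg fun _ => sq_nonneg _)

/-- **`D > 0` when `v_z ≢ 0`** (Ożański: "Claim (ii) follows from (i) and the assumption
`v₁ ≢ 0`"; Scheffer (6.24): `… = 9(4π)⁻¹∫ (z₁)² > 0`). [cite: Ozanski2017NSISingular, Lemma 3.5 (ii)]
[cite: Scheffer1985, (6.24)] -/
theorem interactionLimit_pos (h : IsNSIStructure U v f φ) (hv : ∃ q, (v q).2 ≠ 0) :
    0 < 9 / (4 * π) * ∫ y : EuclideanSpace ℝ (Fin 3), (v (meridian y)).2 ^ 2 := by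
  obtain ⟨q₀, hq₀⟩ := hv
  have hq₀U : q₀ ∈ U := h.tsupport_v_subset (subset_tsupport _ (by
    rw [mem_support]; intro h0; exact hq₀ (by rw [h0]; rfl)))
  have hq₀r : 0 < q₀.1 := h.subset_halfPlane hq₀U
  have heq : (fun y : EuclideanSpace ℝ (Fin 3) => (v (meridian y)).2 ^ 2) =
      fun y => ⟪eZ, swirlField v f y⟫ ^ 2 := by
    funext y; rw [inner_eZ_swirlField]
  have hint : Integrable fun y : EuclideanSpace ℝ (Fin 3) => (v (meridian y)).2 ^ 2 := by
    rw [heq]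
    exact integrable_inner_sq_of_hasCompactSupport h.contDiff_swirlField.continuous
      h.hasCompactSupport_swirlField eZ
  have hcont : Continuous fun y : EuclideanSpace ℝ (Fin 3) => (v (meridian y)).2 ^ 2 :=
    (continuous_snd.comp (h.v_smooth.continuous.comp continuous_meridian)).pow 2
  refine mul_pos (by positivity) ?_
  rw [integral_pos_iff_support_of_nonneg (fun y => sq_nonneg _) hint]
  refine hcont.isOpen_support.measure_pos volume ⟨meridianPoint q₀, ?_⟩
  rw [mem_support, meridian_meridianPoint hq₀r.le]
  exact pow_ne_zero 2 hq₀

/-- The axial profile `s ↦ F_axial(0,s)` is continuous. [folklore] -/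
theorem continuous_pressureInteraction_axis (h : IsNSIStructure U v f φ) :
    Continuous fun s : ℝ => (pressureInteraction v f (0, s)).2 :=
  continuous_snd.comp (h.continuous_pressureInteraction.comp
    (continuous_const.prodMk continuous_id))

/-- The axial profile tends to `0` at `±∞` (from the finite limits `s⁴F_axial(0,s) → ±D`).
[cite: Ozanski2017NSISingular, Lemma 3.5 (i)–(iii)] -/
theorem tendsto_pressureInteraction_axis_cocompact (h : IsNSIStructure U v f φ) :
    Tendsto (fun s : ℝ => (pressureInteraction v f (0, s)).2) (cocompact ℝ) (𝓝 0) := by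
  set g := fun s : ℝ => (pressureInteraction v f (0, s)).2 with hg
  have key : ∀ {l : Filter ℝ} {D : ℝ}, Tendsto (fun s : ℝ => s ^ 4 * g s) l (𝓝 D) →
      Tendsto (fun s : ℝ => s ^ 4) l atTop → Tendsto g l (𝓝 0) := fun {l D} hD h4 => by
    have hinv : Tendsto (fun s : ℝ => (s ^ 4)⁻¹) l (𝓝 0) := tendsto_inv_atTop_zero.comp h4
    have hprod := hD.mul hinv
    rw [mul_zero] at hprod
    refine hprod.congr' ?_
    filter_upwards [h4.eventually_gt_atTop 0] with s hs
    rw [mul_comm (s ^ 4) (g s), mul_inv_cancel_right₀ hs.ne']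
  rw [cocompact_eq_atBot_atTop, tendsto_sup]
  constructor
  · refine key h.tendsto_pow_four_mul_pressureInteraction_atBot ?_
    have h1 : Tendsto (fun s : ℝ => (-s) ^ 4) atBot atTop :=
      (tendsto_pow_atTop four_ne_zero).comp tendsto_neg_atBot_atTop
    exact h1.congr fun s => by ring
  · exact key h.tendsto_pow_four_mul_pressureInteraction_atTop (tendsto_pow_atTop four_ne_zero)

/-- **Lemma 3.5 (ii)** (Ożański 2017): for a structure with `v_z ≢ 0`, the axial component of
`F[v,f]` restricted to the axis attains a positive maximum: there are `A ∈ ℝ` and `B > 0` with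
`B = F_axial(0,A) = max_s F_axial(0,s)` (printed: `B = F₁(A,0) = max_{x₁∈ℝ} F₁(x₁,0)`;
Scheffer 1985, (6.26) and hypothesis (4.3)). [cite: Ozanski2017NSISingular, Lemma 3.5 (ii)]
[cite: Scheffer1985, (6.26)] -/
theorem exists_isMaxOn_pressureInteraction_axis (h : IsNSIStructure U v f φ)
    (hv : ∃ q, (v q).2 ≠ 0) :
    ∃ A B : ℝ, 0 < B ∧ (pressureInteraction v f (0, A)).2 = B ∧
      ∀ s : ℝ, (pressureInteraction v f (0, s)).2 ≤ B := by
  obtain ⟨s₀, -, hs₀⟩ := exists_pos_of_tendsto_pow_four_mul (h.interactionLimit_pos hv)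
    h.tendsto_pow_four_mul_pressureInteraction_atTop
  obtain ⟨A, hA, hmax⟩ := exists_pos_forall_le_of_tendsto_cocompact
    h.continuous_pressureInteraction_axis h.tendsto_pressureInteraction_axis_cocompact hs₀
  exact ⟨A, _, hA, rfl, hmax⟩

/-! ### Lemma 3.5 (v): the size of `F[v,f]` in unit boxes far out along the axis -/

/-- `|n⁴ - s⁴| ≤ 15 K n³` for `|s - n| ≤ K ≤ n/2`, `n > 0`. [folklore] -/
theorem abs_pow_four_sub_pow_four_le {n s K : ℝ} (hn : 0 < n) (hK : |s - n| ≤ K)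
    (hKn : 2 * K ≤ n) : |n ^ 4 - s ^ 4| ≤ 15 * K * n ^ 3 := by
  have hK0 : 0 ≤ K := (abs_nonneg _).trans hK
  have hs : |s - n| ≤ K := hK
  rw [abs_le] at hs
  have hs0 : 0 ≤ s := by linarith
  have hs2 : s ≤ 2 * n := by linarith
  have hfac : n ^ 4 - s ^ 4 = (n - s) * ((n + s) * (n ^ 2 + s ^ 2)) := by ring
  rw [hfac, abs_mul]
  have h1 : |n - s| ≤ K := by rw [abs_sub_comm]; exact hK
  have h2 : |(n + s) * (n ^ 2 + s ^ 2)| ≤ 15 * n ^ 3 := by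
    rw [abs_of_nonneg (by positivity)]
    nlinarith [mul_nonneg hs0 hn.le, sq_nonneg s, sq_nonneg n, mul_nonneg (mul_nonneg hs0 hs0) hn.le]
  calc |n - s| * |(n + s) * (n ^ 2 + s ^ 2)| ≤ K * (15 * n ^ 3) :=
        mul_le_mul h1 h2 (abs_nonneg _) hK0
    _ = 15 * K * n ^ 3 := by ring

/-- **Lemma 3.5 (v), uniform form** (Ożański 2017; a proved strengthening, stated for every
half-width `κ` and every tolerance `ε > 0` in place of the printed `κ = 10⁴C/D`, `ε = 0.001 D`):
for a structure `(v,f,φ)` there is `N > 0` such that for all real `n ≥ N` and all `q = (r,z)`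
with `|r| < 1`, `|z - n| < κ`, `|F_axial(q) - D/n⁴| ≤ ε/n⁴`, where
`D = (9/4π)∫ v_z(R⁻¹y)² dy`. Proof as printed: `|n⁴ - z⁴| ≤ C̃ z³` and (i) on the axis, the mean
value theorem in `r` with the decay `|∇F| ≤ C|q|⁻⁵` of (iii) off it.
[cite: Ozanski2017NSISingular, Lemma 3.5 (v)] [cite: Scheffer1985, (4.14)–(4.17)] -/
theorem pressureInteraction_snd_near_axis (h : IsNSIStructure U v f φ) (κ : ℝ) {ε : ℝ}
    (hε : 0 < ε) :
    ∃ N : ℝ, 0 < N ∧ ∀ n : ℝ, N ≤ n → ∀ q : ℝ × ℝ, |q.1| < 1 → |q.2 - n| < κ →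
      |(pressureInteraction v f q).2 -
          (9 / (4 * π) * ∫ y : EuclideanSpace ℝ (Fin 3), (v (meridian y)).2 ^ 2) / n ^ 4| ≤
        ε / n ^ 4 := by
  set D := 9 / (4 * π) * ∫ y : EuclideanSpace ℝ (Fin 3), (v (meridian y)).2 ^ 2 with hD
  have hD0 : 0 ≤ D := interactionLimit_nonneg v
  set F := pressureInteraction v f with hFdef
  set g := fun s : ℝ => (F (0, s)).2 with hg
  -- (iii): the decay constant
  obtain ⟨C, hC0, hC⟩ := h.exists_pressureInteraction_decay
  -- (i): `s⁴ g(s)` is `ε/48`-close to `D` for `s ≥ S`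
  have hlim := h.tendsto_pow_four_mul_pressureInteraction_atTop
  obtain ⟨S, hS⟩ := eventually_atTop.1 (hlim.eventually (Metric.ball_mem_nhds D (by positivity :
    (0 : ℝ) < ε / 48)))
  set K := max κ 1 with hKdef
  have hK1 : 1 ≤ K := le_max_right _ _
  have hK0 : 0 ≤ K := zero_le_one.trans hK1
  have hκK : κ ≤ K := le_max_left _ _
  -- the threshold
  refine ⟨2 * |S| + 2 * K + 96 * C / ε + 720 * K * D / ε + 2, by positivity, fun n hn q hq1 hq2 => ?_⟩
  have hSn : 2 * |S| ≤ n := by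
    have : 0 ≤ 2 * K + 96 * C / ε + 720 * K * D / ε + 2 := by positivity
    linarith
  have hKn : 2 * K ≤ n := by
    have : 0 ≤ 2 * |S| + 96 * C / ε + 720 * K * D / ε + 2 := by positivity
    linarith
  have hCn : 96 * C / ε ≤ n := by
    have : 0 ≤ 2 * |S| + 2 * K + 720 * K * D / ε + 2 := by positivity
    linarith
  have hDn : 720 * K * D / ε ≤ n := by
    have : 0 ≤ 2 * |S| + 2 * K + 96 * C / ε + 2 := by positivity
    linarith
  have hn2 : 2 ≤ n := by
    have : 0 ≤ 2 * |S| + 2 * K + 96 * C / ε + 720 * K * D / ε := by positivity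
    linarith
  have hn0 : 0 < n := by linarith
  -- the axial coordinate `s = q.2` is large
  set s := q.2 with hsdef
  have hsn : |s - n| ≤ K := hq2.le.trans hκK
  have hsn' := abs_le.1 hsn
  have hs2 : n / 2 ≤ s := by linarith
  have hs1 : 1 ≤ s := by linarith
  have hs0 : 0 < s := by linarith
  have hsS : S ≤ s := by linarith [le_abs_self S]
  have hs4 : (s ^ 4)⁻¹ ≤ 16 / n ^ 4 := by
    rw [inv_eq_one_div, div_le_div_iff₀ (by positivity) (by positivity), one_mul]
    have : (n / 2) ^ 4 ≤ s ^ 4 := pow_le_pow_left₀ (by positivity) hs2 4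
    nlinarith
  have hs5 : (s ^ 5)⁻¹ ≤ 32 / n ^ 5 := by
    rw [inv_eq_one_div, div_le_div_iff₀ (by positivity) (by positivity), one_mul]
    have : (n / 2) ^ 5 ≤ s ^ 5 := pow_le_pow_left₀ (by positivity) hs2 5
    nlinarith
  -- Term B: `|g(s) - D/s⁴| ≤ (ε/48)/s⁴ ≤ ε/(3n⁴)`
  have hB : |g s - D / s ^ 4| ≤ ε / 3 / n ^ 4 := by
    have h1 : dist (s ^ 4 * g s) D < ε / 48 := hS s hsS
    rw [Real.dist_eq] at h1
    have h2 : g s - D / s ^ 4 = (s ^ 4 * g s - D) * (s ^ 4)⁻¹ := by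
      rw [sub_mul, mul_comm (s ^ 4) (g s), mul_inv_cancel_right₀ (pow_ne_zero 4 hs0.ne'),
        div_eq_mul_inv]
    rw [h2, abs_mul, abs_of_pos (inv_pos.2 (pow_pos hs0 4))]
    calc |s ^ 4 * g s - D| * (s ^ 4)⁻¹ ≤ ε / 48 * (16 / n ^ 4) :=
          mul_le_mul h1.le hs4 (by positivity) (by positivity)
      _ = ε / 3 / n ^ 4 := by ring
  -- Term A: the mean value theorem in the radial variable
  have hA : |(F q).2 - g s| ≤ ε / 3 / n ^ 4 := by
    have hconv : Convex ℝ (Icc (-1 : ℝ) 1 ×ˢ ({s} : Set ℝ)) :=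
      (convex_Icc _ _).prod (convex_singleton s)
    have hdiff : ∀ p ∈ Icc (-1 : ℝ) 1 ×ˢ ({s} : Set ℝ), DifferentiableAt ℝ F p := fun p _ =>
      (h.contDiff_pressureInteraction.differentiable (by decide)) p
    have hbound : ∀ p ∈ Icc (-1 : ℝ) 1 ×ˢ ({s} : Set ℝ), ‖fderiv ℝ F p‖ ≤ C / s ^ 5 := by
      rintro p ⟨-, hp2⟩
      rw [mem_singleton_iff] at hp2
      have hps : s ≤ ‖p‖ := by
        rw [Prod.norm_def, ← hp2]; exact (le_abs_self _).trans (le_max_right _ _)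
      have hp0 : p ≠ 0 := by
        intro h0; rw [h0, norm_zero] at hps; linarith
      refine ((hC p hp0).2).trans ?_
      exact div_le_div_of_nonneg_left hC0.le (by positivity) (pow_le_pow_left₀ hs0.le hps 5)
    have hqmem : q ∈ Icc (-1 : ℝ) 1 ×ˢ ({s} : Set ℝ) :=
      ⟨⟨(abs_lt.1 hq1).1.le, (abs_lt.1 hq1).2.le⟩, rfl⟩
    have h0mem : ((0 : ℝ), s) ∈ Icc (-1 : ℝ) 1 ×ˢ ({s} : Set ℝ) :=
      ⟨⟨by norm_num, by norm_num⟩, rfl⟩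
    have hmvt := hconv.norm_image_sub_le_of_norm_fderiv_le hdiff hbound h0mem hqmem
    have hdist : ‖q - ((0 : ℝ), s)‖ = |q.1| := by
      rw [Prod.norm_def]; simp [hsdef]
    rw [hdist] at hmvt
    calc |(F q).2 - g s| = ‖(F q - F (0, s)).2‖ := by simp [hg, Real.norm_eq_abs]
      _ ≤ ‖F q - F (0, s)‖ := norm_snd_le _
      _ ≤ C / s ^ 5 * |q.1| := hmvt
      _ ≤ C / s ^ 5 * 1 := by gcongr
      _ ≤ C * (32 / n ^ 5) := by
          rw [mul_one, div_eq_mul_inv]; exact mul_le_mul_of_nonneg_left hs5 hC0.le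
      _ = 32 * C / n / n ^ 4 := by field_simp
      _ ≤ ε / 3 / n ^ 4 := by
          refine div_le_div_of_nonneg_right ?_ (by positivity)
          rw [div_le_iff₀ hn0]
          have := (div_le_iff₀ hε).1 hCn
          linarith
  -- Term C: `|D/s⁴ - D/n⁴| ≤ 240 K D/n⁵ ≤ ε/(3n⁴)`
  have hCterm : |D / s ^ 4 - D / n ^ 4| ≤ ε / 3 / n ^ 4 := by
    have h1 : D / s ^ 4 - D / n ^ 4 = D * (n ^ 4 - s ^ 4) * ((s ^ 4)⁻¹ * (n ^ 4)⁻¹) := by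
      field_simp
    rw [h1, abs_mul, abs_mul, abs_of_nonneg hD0,
      abs_of_pos (by positivity : (0 : ℝ) < (s ^ 4)⁻¹ * (n ^ 4)⁻¹)]
    have h2 := abs_pow_four_sub_pow_four_le hn0 hsn hKn
    calc D * |n ^ 4 - s ^ 4| * ((s ^ 4)⁻¹ * (n ^ 4)⁻¹)
        ≤ D * (15 * K * n ^ 3) * (16 / n ^ 4 * (n ^ 4)⁻¹) := by
          gcongr
      _ = 240 * K * D / n / n ^ 4 := by field_simp; ring
      _ ≤ ε / 3 / n ^ 4 := by
          refine div_le_div_of_nonneg_right ?_ (by positivity)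
          rw [div_le_iff₀ hn0]
          have := (div_le_iff₀ hε).1 hDn
          linarith
  -- conclusion
  calc |(F q).2 - D / n ^ 4|
      = |((F q).2 - g s) + (g s - D / s ^ 4) + (D / s ^ 4 - D / n ^ 4)| := by ring_nf
    _ ≤ |(F q).2 - g s| + |g s - D / s ^ 4| + |D / s ^ 4 - D / n ^ 4| := abs_add_three _ _ _
    _ ≤ ε / 3 / n ^ 4 + ε / 3 / n ^ 4 + ε / 3 / n ^ 4 := add_le_add (add_le_add hA hB) hCterm
    _ = ε / n ^ 4 := by ring

/-- **Lemma 3.5 (v), as printed** (Ożański 2017): let `D = (9/4π)∫ v_z(R⁻¹y)² dy` (`> 0` as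
`v_z ≢ 0`) and `κ = 10⁴C/D`; there is `N > 0` such that for `n ≥ N`, `|z - n| < κ`, `|r| < 1`
imply `|F_axial(r,z) - n⁻⁴D| ≤ 0.001 n⁻⁴D` (printed for the decay constant `C > 0` of (iii),
"Note `C ≥ D`"; true for every real `C`, being the case `ε = 0.001 D` of the uniform form).
[cite: Ozanski2017NSISingular, Lemma 3.5 (v)] [cite: Scheffer1985, (4.14)–(4.17)] -/
theorem pressureInteraction_snd_near_axis_printed (h : IsNSIStructure U v f φ)
    (hv : ∃ q, (v q).2 ≠ 0) (C : ℝ) :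
    ∃ N : ℝ, 0 < N ∧ ∀ n : ℝ, N ≤ n → ∀ q : ℝ × ℝ,
      |q.2 - n| < 10 ^ 4 * C /
          (9 / (4 * π) * ∫ y : EuclideanSpace ℝ (Fin 3), (v (meridian y)).2 ^ 2) →
        |q.1| < 1 →
      |(pressureInteraction v f q).2 -
          (9 / (4 * π) * ∫ y : EuclideanSpace ℝ (Fin 3), (v (meridian y)).2 ^ 2) / n ^ 4| ≤
        1 / 10 ^ 3 *
          ((9 / (4 * π) * ∫ y : EuclideanSpace ℝ (Fin 3), (v (meridian y)).2 ^ 2) / n ^ 4) := by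
  have hD0 : 0 < 9 / (4 * π) * ∫ y : EuclideanSpace ℝ (Fin 3), (v (meridian y)).2 ^ 2 :=
    h.interactionLimit_pos hv
  obtain ⟨N, hN, hmain⟩ := h.pressureInteraction_snd_near_axis
    (10 ^ 4 * C / (9 / (4 * π) * ∫ y : EuclideanSpace ℝ (Fin 3), (v (meridian y)).2 ^ 2))
    (by positivity :
      (0 : ℝ) < 1 / 10 ^ 3 * (9 / (4 * π) * ∫ y : EuclideanSpace ℝ (Fin 3), (v (meridian y)).2 ^ 2))
  refine ⟨N, hN, fun n hn q hq2 hq1 => ?_⟩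
  calc _ ≤ _ := hmain n hn q hq1 hq2
    _ = _ := by ring

end IsNSIStructure

end Literature.Barriers.NavierStokesRegularity

end
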